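import Mathlib.Data.Int.Basic
import Summits.Ventures.PackingBounds.Energy.EightPointCkFourGramD
import Summits.Ventures.PackingBounds.Energy.NFGramPSDRows
import HarnessLib

/-!
# Deviation facts for block SOS, rows 48–62

Framing: lottery ticket; floor = certified bounds/negative ranges. Venture `PackingBounds`, cell `pub-packcert`, energy family E3PT (pub-packcert-energy gen 22;
KERNEL-NF data route, generator `code/e3pt/g22/nfkernel/nfgram_emit.py`). Source certificate `pub-packcert-energy/certs/e3pt/e3pt-sharp-n3N8ck4d6F-none.json`, block `SOS` (r = 63),
field degree 3 (ξ enclosed by 349702709 ≤ 2^30·ξ ≤ 349702710).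
-/

namespace Summit.Ventures.PackingBounds.Energy.EightPointCkFour

set_option maxRecDepth 100000
set_option maxHeartbeats 0
open Summit.Ventures.PackingBounds.Energy

/-- Deviation check, rows 48 ≤ i < 56: lengths, denominators, dev_ij ≤ C_ij·Dn_ij, Σ_j(C_ij+C_ji) ≤ 2·m·Dx^ℓ. -/
theorem devS_48_56 : NFGram.checkDev2Rows 63 3 48 56 349702709 349702710 1073741824 fDS nDS cDS yDS 1152921504606846976 258860425819491 = true := by decide +kernel

/-- Deviation check, rows 56 ≤ i < 63: lengths, denominators, dev_ij ≤ C_ij·Dn_ij, Σ_j(C_ij+C_ji) ≤ 2·m·Dx^ℓ. -/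
theorem devS_56_63 : NFGram.checkDev2Rows 63 3 56 63 349702709 349702710 1073741824 fDS nDS cDS yDS 1152921504606846976 258860425819491 = true := by decide +kernel


end Summit.Ventures.PackingBounds.Energy.EightPointCkFour
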